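/-
Copyright (c) 2026 the pub-hodgecm-mathlib formalisation cell (harness21).  Prover seat hodgecm-mathlib-F0P3a-p05 (g17): road «S3-ram» (LEAD F0P3a-plan (g13); owner
F0P3a-p06 (g15); (Cnt2′) chair F0P3a-p07 (g14)), organ (z1-f) «W-SIDE CURRENCY BRIDGE, RANK 2», brick 3: the wrappers at the CM place; 2026-09-02.
-/
import Literature.NumberTheory.Rogawski1990.DepthZeroKappaTransferTypeTwoRamifiedDepthBalls          -- ★ (B-i) even (A-p12 (g24)): `natCard_depthFixed_selfDual_and_modular_of_even_depth_ramified`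
import Literature.NumberTheory.Rogawski1990.DepthZeroKappaTransferTypeTwoRamifiedDepthBallsTop       -- ★ (B-i) top: `natCard_depthFixed_selfDual_top_of_even_depth_ramified`
import Literature.NumberTheory.Rogawski1990.DepthZeroKappaTransferTypeTwoRamifiedShellClassLaw       -- ★ (B-ii) master (A-p12 (g24)): `natCard_class_eq_natCard_class_of_even_depth_ramified`, `forall_v_conj_sub_smul_one_le_iff`, `forall_v_mul_mul_apply_le`
import Literature.NumberTheory.Rogawski1990.RankOneKappaVertexCoverCM                            -- ★ `exists_vertexCover_of_ramified` (the `C′` column's stabiliser, to call (B-i))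
import Literature.NumberTheory.Automorphic.UnitaryLatticeTreeCentredTokensDictionary                -- ★ p848132 (this seat): brick 2, the generic dictionary; brings ★ p848050 (rank-2 transitivity), ★ p847316, ★ p847541
import Literature.NumberTheory.Automorphic.UnitaryTwoRamifiedTreeStabilizers                       -- ★ `v_det_coe_eq_one_of_mem_placeForm`, `mem_glInt_iff_forall_v_le_one_and_v_det_eq_one`
import HarnessLib

/-!
# The W-side lattice currency of the (T2) rows at a tame-ramified place: architect A-p12's rank-2 COSET counts (B-i)∕(B-ii) as counts of `γ_W`-fixed self-dual LATTICES of
# `(L_w², Φ₂)` with the PLAIN tokens of ★ p847724 ∕ ★ (z1-e) (Labesse–Langlands 1979 §2; Kottwitz 1986 §3; Rogawski 1990 §4.9)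

Topic `NumberTheory/Rogawski1990`; namespace `Literature.NumberTheory.Automorphic.UnitaryGroup`.  THEOREMS ONLY (no definition, no instance, no notation, no named fact,
no `sorry`); kernel lane `--supports stmt-HodgeConjecture-24833`.  Cell `pub/hodgecm-mathlib` (D-0151), crux H413; road «S3-ram» (Literature seeding, count-neutral), (T2) G-side
organ (Cnt2′) of F0P3a-p07 (g14)'s skeleton, sub-organ **(z1-f)** «W-SIDE CURRENCY BRIDGE, RANK 2» (chair hand (4), 2026-09-02T02:17:05Z), brick 3 of 3 (★ p848050 rank-2
self-dual transitivity; ★ p848132 the generic centred-token dictionary).  The right-hand sides of the chair's ★ (z1-e) `ncard_selfDual_fixed_axis_{zero,bd,reg,rankOne_class,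
rankOne_not_class}_eq` are W-counts `#{B : Submodule 𝒪_w (Fin 2 → L_w) ∣ IsSelfDualLattice σ_w ϖ (placeForm J₂ w.1) B ∧ mapGL (e₂ γ₂) B = B ∧ TOKENS(e₂ γ₂ − 1, B)}`, `e₂` the
one-place model ★ `localNonsplitEquiv`; architect A-p12 (g24)'s ★ (B-i)∕(B-ii) count COSETS `hK⁰ ∈ U₂ ⧸ K⁰` labelled through the CENTRED monodromy `E₂(h⁻¹γ₂h) − ½tr·1`.
THIS FILE rewrites the latter in the former currency:

* §1 **`natCard_cosets_label_eq_ncard_selfDual_fixed_ramified`** — THE MASTER at the place: for any coset label `P(Y_h)` (integral-forcing, `GL₂(𝒪_w)`-conjugation invariant) and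
  lattice label `Q` with `P(g⁻¹(e₂γ₂)g) ↔ Q(g·𝒪_w²)`: `Nat.card {x : U₂⧸K⁰ ∣ ∃ h, x = ↑h ∧ P(E₂(h⁻¹γ₂h))} = #{B ∣ B self-dual, (e₂γ₂)B = B, Q B}` (set shape ★
  `natCard_setOf_exists_mk_eq_ncard_fixedBy_sep` ∘ frame transport ★ `ncard_fixedBy_sep_congr` along `e₂` (`K⁰ = e₂⁻¹GL₂(𝒪_w)`, ★ `mem_localIntegralLevel_iff_of_smul_eq`) ∘ the
  dictionary ★ `ncard_fixedBy_quotient_sep_eq_ncard_selfDual_fixed_sep` with the root self-dual and `U₂` transitive, ★ p848050).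
* §2 (B-i) IN LATTICE CURRENCY: **`ncard_selfDual_fixed_centredBall_eq_of_even_depth_ramified`** — `#{B ∣ SD, fixed, (e₂γ₂ − c·1)B ⊆ ϖ^{2j}B} = (q+1)·Σ_(k<n−j) q^k` (`j < n`; the
  `C′` column of (B-i) is supplied internally by ★ `exists_vertexCover_of_ramified`), and **ROW `0`**: `ncard_selfDual_fixed_lev_lev_eq_of_even_depth_ramified` — for `e₂γ₂` 2-deep
  (`|(e₂γ₂ − 1)_{ab}| ≤ |ϖ²|`, so `|c − 1| ≤ |ϖ²|`): `#{B ∣ SD, fixed, LEV(ϖ) ∧ LEV(ϖ²)} = (q+1)·Σ_(k<n−1) q^k` (`n ≥ 2`) and `= 0`-shaped top case `n = 1`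
  (`ncard_selfDual_fixed_lev_lev_eq_zero_of_even_depth_one_ramified`).
* §3 (B-ii) IN LATTICE CURRENCY, ROWS `1±`: **`ncard_selfDual_fixed_shell_class_eq_of_even_depth_ramified`** — for `e₂γ₂` 2-deep and units `c₀, c₁`:
  `#{B ∣ SD, fixed, LEV(ϖ) ∧ ¬LEV(ϖ²) ∧ LEV₂(ϖ³) ∧ CLS(c₀)} = #{B ∣ …, CLS(c₁)}` (the PLAIN tokens of ★ `ncard_selfDual_fixed_axis_rankOne_class_eq`'s right side), from ★
  `natCard_class_eq_natCard_class_of_even_depth_ramified` with the `GL₂(𝒪_w)`-stable family `S = ` «centred depth-1-not-2 shell with `(Y−c)²` `ϖ³`-deep» and `ϖ₁ = ϖ⁻¹`, the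
  centred ↔ plain conversions of ★ p848132 §2.

HONEST LABEL: HC_CM is proved only modulo the 2 remaining named inputs (hLiu418 24832, h413 24833) until rung 0 closes; nothing printed is asserted here (currency bookkeeping over ★
results); «S3-ram» has no books consequence.

## References
* [LabesseLanglands1979] J.-P. Labesse, R. P. Langlands, *L-indistinguishability for SL(2)*, Canad. J. Math. 31 (1979): §2 Lemma 2.1 p. 8.
* [Kottwitz1986] R. E. Kottwitz, *Base change for unit elements of Hecke algebras*, Compositio Math. 60 (1986): §3.
* [Rogawski1990] J. D. Rogawski, *Automorphic Representations of Unitary Groups in Three Variables* (1990): §4.9 pp. 54–56.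
-/

set_option autoImplicit false

noncomputable section

open MeasureTheory Measure Set NumberField IsDedekindDomain Matrix ValuativeRel MulAction Finset Polynomial
open scoped ValuativeRel Matrix MatrixGroups WithZero

namespace Literature.NumberTheory.Automorphic.UnitaryGroup

open Literature.NumberTheory.Rogawski1990 Literature.NumberTheory.Automorphic Literature.NumberTheory.Automorphic.IntegralReduction
open Literature.GroupTheory Literature.NumberTheory.GaloisRepresentations
open Literature.NumberTheory.Automorphic.UnitaryLatticeTree Literature.NumberTheory.Automorphic.HermitianLattice

variable (L : Type) [Field L] [NumberField L] [IsCMField L] (v : HeightOneSpectrum (𝓞 ↥(maximalRealSubfield L)))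
  (w : PlacesOver L v) (hw : IsCMField.complexConj L • w.1 = w.1)


/-! ## §0 One generic rewrite: the centred label of a `GL_N(𝒪)`-conjugate (units spelling) -/

/-- `|((k⁻¹xk) − c·1)_{ab}| ≤ |r| ∀ab ⟺ |(x − c·1)_{ab}| ≤ |r| ∀ab` for `k ∈ GL_N(𝒪)` — ★ `forall_v_conj_sub_smul_le_iff_of_mem_glInt` with the conjugate spelled in `GL_N`.
[cite: Kottwitz1986, §3] -/
theorem _root_.Literature.NumberTheory.Automorphic.UnitaryLatticeTree.forall_v_units_conj_sub_smul_le_iff_of_mem_glInt {K : Type*} [Field K] [Valued K ℤᵐ⁰]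
    [ValuativeRel K] [(Valued.v : Valuation K ℤᵐ⁰).Compatible] {N : ℕ} {k : GL (Fin N) K} (hk : k ∈ glInt N K) (x : GL (Fin N) K) (c r : K) :
    (∀ a b, Valued.v (((((k⁻¹ * x * k : GL (Fin N) K)) : Matrix (Fin N) (Fin N) K) - c • (1 : Matrix (Fin N) (Fin N) K)) a b) ≤ Valued.v r) ↔
      ∀ a b, Valued.v (((x : Matrix (Fin N) (Fin N) K) - c • (1 : Matrix (Fin N) (Fin N) K)) a b) ≤ Valued.v r := by
  rw [Units.val_mul, Units.val_mul, Matrix.coe_units_inv]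
  exact forall_v_conj_sub_smul_le_iff_of_mem_glInt hk _ c r

/-- `(g⁻¹Ag)² = g⁻¹A²g`. [cite: Kottwitz1986, §3] -/
theorem _root_.Literature.NumberTheory.Automorphic.UnitaryLatticeTree.inv_mul_mul_sq {K : Type*} [Field K] {N : ℕ} (g : GL (Fin N) K) (A : Matrix (Fin N) (Fin N) K) :
    ((g : Matrix (Fin N) (Fin N) K)⁻¹ * A * (g : Matrix (Fin N) (Fin N) K)) ^ 2 = (g : Matrix (Fin N) (Fin N) K)⁻¹ * A ^ 2 * (g : Matrix (Fin N) (Fin N) K) := by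
  rw [pow_two, pow_two]
  simp only [Matrix.mul_assoc]
  rw [Matrix.mul_nonsing_inv_cancel_left _ _ (Matrix.isUnits_det_units g)]

/-- Integral two-sided multiplication preserves entrywise bounds. [cite: Serre1980Trees, Ch. II §1.1] -/
theorem _root_.Literature.NumberTheory.Automorphic.UnitaryLatticeTree.forall_v_mul_mul_apply_le_of_forall {K : Type*} [Field K] [Valued K ℤᵐ⁰] {N : ℕ}
    {P Q Z : Matrix (Fin N) (Fin N) K} {r : K} (hP : ∀ a b, Valued.v (P a b) ≤ 1) (hQ : ∀ a b, Valued.v (Q a b) ≤ 1)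
    (hZ : ∀ a b, Valued.v (Z a b) ≤ Valued.v r) : ∀ a b, Valued.v ((P * Z * Q) a b) ≤ Valued.v r := by
  intro a b
  rw [Matrix.mul_apply]
  refine Valuation.map_sum_le _ fun j _ => ?_
  rw [map_mul, Matrix.mul_apply]
  refine (mul_le_mul' (Valuation.map_sum_le _ fun i _ => ?_) (hQ j b)).trans (by rw [mul_one])
  rw [map_mul]
  exact (mul_le_mul' (hP a i) (hZ i j)).trans (by rw [one_mul])

/-- The SQUARE label `|((x − c·1)²)_{ab}| ≤ |r|` is invariant under `GL_N(𝒪)`-conjugation (units spelling). [cite: Kottwitz1986, §3] -/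
theorem _root_.Literature.NumberTheory.Automorphic.UnitaryLatticeTree.forall_v_units_conj_sub_smul_sq_le_iff_of_mem_glInt {K : Type*} [Field K] [Valued K ℤᵐ⁰]
    [ValuativeRel K] [(Valued.v : Valuation K ℤᵐ⁰).Compatible] {N : ℕ} {k : GL (Fin N) K} (hk : k ∈ glInt N K) (x : GL (Fin N) K) (c r : K) :
    (∀ a b, Valued.v ((((((k⁻¹ * x * k : GL (Fin N) K)) : Matrix (Fin N) (Fin N) K) - c • (1 : Matrix (Fin N) (Fin N) K)) ^ 2) a b) ≤ Valued.v r) ↔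
      ∀ a b, Valued.v ((((x : Matrix (Fin N) (Fin N) K) - c • (1 : Matrix (Fin N) (Fin N) K)) ^ 2) a b) ≤ Valued.v r := by
  obtain ⟨hki, hki'⟩ := (Literature.NumberTheory.Automorphic.mem_glInt_iff_forall_v_le_one k).1 hk
  have hkinv : (k : Matrix (Fin N) (Fin N) K)⁻¹ = (((k⁻¹ : GL (Fin N) K)) : Matrix (Fin N) (Fin N) K) := (Matrix.coe_units_inv k).symm
  have hki'' : ∀ a b, Valued.v ((k : Matrix (Fin N) (Fin N) K)⁻¹ a b) ≤ 1 := by rw [hkinv]; exact hki'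
  have e : ((((k⁻¹ * x * k : GL (Fin N) K)) : Matrix (Fin N) (Fin N) K) - c • (1 : Matrix (Fin N) (Fin N) K)) ^ 2 =
      (k : Matrix (Fin N) (Fin N) K)⁻¹ * (((x : Matrix (Fin N) (Fin N) K) - c • (1 : Matrix (Fin N) (Fin N) K)) ^ 2) * (k : Matrix (Fin N) (Fin N) K) := by
    rw [coe_inv_mul_mul_sub_smul_one_eq_conj, inv_mul_mul_sq]
  rw [e]
  constructor
  · intro h
    have h' := forall_v_mul_mul_apply_le_of_forall hki hki'' h
    have e' : (k : Matrix (Fin N) (Fin N) K) * ((k : Matrix (Fin N) (Fin N) K)⁻¹ * (((x : Matrix (Fin N) (Fin N) K) - c • (1 : Matrix (Fin N) (Fin N) K)) ^ 2) * (k : Matrix (Fin N) (Fin N) K)) * (k : Matrix (Fin N) (Fin N) K)⁻¹ =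
        ((x : Matrix (Fin N) (Fin N) K) - c • (1 : Matrix (Fin N) (Fin N) K)) ^ 2 := by
      rw [Matrix.mul_assoc, Matrix.mul_assoc, Matrix.mul_nonsing_inv _ (Matrix.isUnits_det_units k), Matrix.mul_one,
        Matrix.mul_nonsing_inv_cancel_left _ _ (Matrix.isUnits_det_units k)]
    rw [e'] at h'
    exact h'
  · exact fun h => forall_v_mul_mul_apply_le_of_forall hki'' hki h

/-- **THE CENTRED SQUARE LABEL IS THE `LEV₂` TOKEN**: `|((g⁻¹γg − c·1)²)_{ab}| ≤ |r| ∀ab ⟺ (γ − c·1)²·(g·L₀) ⊆ r·(g·L₀)` (`r ≠ 0`). [cite: Kottwitz1986, §3] -/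
theorem _root_.Literature.NumberTheory.Automorphic.UnitaryLatticeTree.forall_v_units_conj_sub_smul_sq_le_iff_map_sq_le_scaleLattice {K : Type*} [Field K] [Valued K ℤᵐ⁰] {N : ℕ}
    {r : K} (hr : r ≠ 0) (γ g : GL (Fin N) K) (c : K) :
    (∀ a b, Valued.v ((((((g⁻¹ * γ * g : GL (Fin N) K)) : Matrix (Fin N) (Fin N) K) - c • (1 : Matrix (Fin N) (Fin N) K)) ^ 2) a b) ≤ Valued.v r) ↔
      (mapGL g (stdLattice K N)).map ((Matrix.toLin' ((((γ : Matrix (Fin N) (Fin N) K) - c • (1 : Matrix (Fin N) (Fin N) K))) ^ 2)).restrictScalars (Valued.integer K)) ≤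
        scaleLattice r (mapGL g (stdLattice K N)) := by
  rw [map_toLin'_mapGL_stdLattice_le_scaleLattice_iff hr, coe_inv_mul_mul_sub_smul_one_eq_conj, inv_mul_mul_sq]


/-! ## §1 The master: labelled `K⁰`-coset counts of `U₂` are labelled counts of `γ_W`-fixed self-dual lattices of `(L_w², Φ₂)` -/

set_option maxHeartbeats 1600000 in
-- budget only: statement-heavy CM-place tokens (two currencies).
include hw in
/-- **THE MASTER AT THE PLACE.**  `v` non-split in the CM field `L` with `|2|_w = 1`, `ϖ` a uniformiser of `L_w`, `e₂ = E₂` the one-place model (★ `localNonsplitEquiv`),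
`K⁰ = e₂⁻¹ GL₂(𝒪_w)`.  For `γ₂ ∈ U₂`, a COSET label `P` on matrices that forces integrality (`P(E₂ x) ⇒ E₂ x` integral) and is invariant under `GL₂(𝒪_w) ∩ U`-conjugation, and a
LATTICE label `Q` with `P(g⁻¹(e₂γ₂)g) ⟺ Q(g·𝒪_w²)` whenever `g⁻¹(e₂γ₂)g ∈ GL₂(𝒪_w)`:
`Nat.card {x : U₂ ⧸ K⁰ ∣ ∃ h, x = hK⁰ ∧ P(E₂(h⁻¹γ₂h))} = #{B ∣ B self-dual for (σ_w, ϖ, Φ₂,w), (e₂γ₂)B = B, Q B}`. [cite: Kottwitz1986, §3] [cite: LabesseLanglands1979, §2 Lemma 2.1 p. 8]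
[cite: Rogawski1990, §4.9 p. 54] -/
theorem natCard_cosets_label_eq_ncard_selfDual_fixed_ramified (h2 : IsUnit (2 : 𝒪[(w.1.adicCompletion L)]))
    (ϖ : (w.1.adicCompletion L)ˣ) (hϖ : Valued.v (ϖ : (w.1.adicCompletion L)) = WithZero.exp (-1 : ℤ)) (γ₂ : ((cmDatum L 2 (Matrix.of fun i j : Fin 2 => if i.val + j.val + 1 = 2 then (1 : L) else 0)).Local v))
    (P : Matrix (Fin 2) (Fin 2) (w.1.adicCompletion L) → Prop) (Q : Submodule (Valued.integer (w.1.adicCompletion L)) (Fin 2 → (w.1.adicCompletion L)) → Prop)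
    (hPint : ∀ x : ((cmDatum L 2 (Matrix.of fun i j : Fin 2 => if i.val + j.val + 1 = 2 then (1 : L) else 0)).Local v), P ((((localNonsplitEquiv (IsCMField.complexConj L) (Matrix.of fun i j : Fin 2 => if i.val + j.val + 1 = 2 then (1 : L) else 0) (IsCMField.complexConj_ne_one L) w hw) x : ↥(unitaryGroupOfForm (galAdicCompletionMap (L := L) (IsCMField.complexConj L) hw) (placeForm (Matrix.of fun i j : Fin 2 => if i.val + j.val + 1 = 2 then (1 : L) else 0) w.1))) : GL (Fin 2) (w.1.adicCompletion L)) : Matrix (Fin 2) (Fin 2) (w.1.adicCompletion L)) → ∀ a b, Valued.v (((((localNonsplitEquiv (IsCMField.complexConj L) (Matrix.of fun i j : Fin 2 => if i.val + j.val + 1 = 2 then (1 : L) else 0) (IsCMField.complexConj_ne_one L) w hw) x : ↥(unitaryGroupOfForm (galAdicCompletionMap (L := L) (IsCMField.complexConj L) hw) (placeForm (Matrix.of fun i j : Fin 2 => if i.val + j.val + 1 = 2 then (1 : L) else 0) w.1))) : GL (Fin 2) (w.1.adicCompletion L)) : Matrix (Fin 2) (Fin 2) (w.1.adicCompletion L))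 a b) ≤ 1)
    (hPconj : ∀ k x : ↥(unitaryGroupOfForm (galAdicCompletionMap (L := L) (IsCMField.complexConj L) hw) (placeForm (Matrix.of fun i j : Fin 2 => if i.val + j.val + 1 = 2 then (1 : L) else 0) w.1)), ((k : ↥(unitaryGroupOfForm (galAdicCompletionMap (L := L) (IsCMField.complexConj L) hw) (placeForm (Matrix.of fun i j : Fin 2 => if i.val + j.val + 1 = 2 then (1 : L) else 0) w.1))) : GL (Fin 2) (w.1.adicCompletion L)) ∈ glInt 2 (w.1.adicCompletion L) → ((x : ↥(unitaryGroupOfForm (galAdicCompletionMap (L := L) (IsCMField.complexConj L) hw) (placeForm (Matrix.of fun i j : Fin 2 => if i.val + j.val + 1 = 2 then (1 : L) else 0) w.1))) : GL (Fin 2) (w.1.adicCompletion L)) ∈ glInt 2 (w.1.adicCompletion L) → (P ((((k⁻¹ * x * k) : ↥(unitaryGroupOfForm (galAdicCompletionMap (L := L) (IsCMField.complexConj L) hw) (placeForm (Matrix.of fun i j : Fin 2 => if i.val + j.val + 1 = 2 then (1 : L) else 0) w.1))) : GL (Fin 2) (w.1.adicCompletion L)) : Matrix (Fin 2) (Fin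 2) (w.1.adicCompletion L)) ↔ P (((x : ↥(unitaryGroupOfForm (galAdicCompletionMap (L := L) (IsCMField.complexConj L) hw) (placeForm (Matrix.of fun i j : Fin 2 => if i.val + j.val + 1 = 2 then (1 : L) else 0) w.1))) : GL (Fin 2) (w.1.adicCompletion L)) : Matrix (Fin 2) (Fin 2) (w.1.adicCompletion L))))
    (hPQ : ∀ g : ↥(unitaryGroupOfForm (galAdicCompletionMap (L := L) (IsCMField.complexConj L) hw) (placeForm (Matrix.of fun i j : Fin 2 => if i.val + j.val + 1 = 2 then (1 : L) else 0) w.1)), (((g⁻¹ * ((localNonsplitEquiv (IsCMField.complexConj L) (Matrix.of fun i j : Fin 2 => if i.val + j.val + 1 = 2 then (1 : L) else 0) (IsCMField.complexConj_ne_one L) w hw) γ₂ : ↥(unitaryGroupOfForm (galAdicCompletionMap (L := L) (IsCMField.complexConj L) hw) (placeForm (Matrix.of fun i j : Fin 2 => if i.val + j.val + 1 = 2 then (1 : L) else 0) w.1))) * g) : ↥(unitaryGroupOfForm (galAdicCompletionMap (L := L) (IsCMField.complexConj L) hw) (placeForm (Matrix.of fun i j : Fin 2 => if i.val + j.val + 1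 = 2 then (1 : L) else 0) w.1))) : GL (Fin 2) (w.1.adicCompletion L)) ∈ glInt 2 (w.1.adicCompletion L) →
      (P ((((g⁻¹ * ((localNonsplitEquiv (IsCMField.complexConj L) (Matrix.of fun i j : Fin 2 => if i.val + j.val + 1 = 2 then (1 : L) else 0) (IsCMField.complexConj_ne_one L) w hw) γ₂ : ↥(unitaryGroupOfForm (galAdicCompletionMap (L := L) (IsCMField.complexConj L) hw) (placeForm (Matrix.of fun i j : Fin 2 => if i.val + j.val + 1 = 2 then (1 : L) else 0) w.1))) * g) : ↥(unitaryGroupOfForm (galAdicCompletionMap (L := L) (IsCMField.complexConj L) hw) (placeForm (Matrix.of fun i j : Fin 2 => if i.val + j.val + 1 = 2 then (1 : L) else 0) w.1))) : GL (Fin 2) (w.1.adicCompletion L)) : Matrix (Fin 2) (Fin 2) (w.1.adicCompletion L)) ↔ Q (mapGL ((g : ↥(unitaryGroupOfForm (galAdicCompletionMap (L := L) (IsCMField.complexConj L) hw) (placeForm (Matrix.of fun i j : Fin 2 => if i.val + j.val + 1 = 2 then (1 : L) else 0) w.1))) : GL (Fin 2) (w.1.adicCompletion L)) (stdLattice (w.1.adicCompletion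 L) 2)))) :
    Nat.card {x : ((cmDatum L 2 (Matrix.of fun i j : Fin 2 => if i.val + j.val + 1 = 2 then (1 : L) else 0)).Local v) ⧸ (cmLocalIntegralLevel L 2 (Matrix.of fun i j : Fin 2 => if i.val + j.val + 1 = 2 then (1 : L) else 0) v) | ∃ h : ((cmDatum L 2 (Matrix.of fun i j : Fin 2 => if i.val + j.val + 1 = 2 then (1 : L) else 0)).Local v), x = (h : ((cmDatum L 2 (Matrix.of fun i j : Fin 2 => if i.val + j.val + 1 = 2 then (1 : L) else 0)).Local v) ⧸ (cmLocalIntegralLevel L 2 (Matrix.of fun i j : Fin 2 => if i.val + j.val + 1 = 2 then (1 : L) else 0) v)) ∧ P ((((localNonsplitEquiv (IsCMField.complexConj L) (Matrix.of fun i j : Fin 2 => if i.val + j.val + 1 = 2 then (1 : L) else 0) (IsCMField.complexConj_ne_one L) w hw) (h⁻¹ * γ₂ * h) : ↥(unitaryGroupOfForm (galAdicCompletionMap (L := L) (IsCMField.complexConj L) hw) (placeForm (Matrix.of fun i j : Fin 2 => if i.val + j.val + 1 = 2 then (1 : L) else 0) w.1))) : GL (Fin 2) (w.1.adicCompletion L))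 : Matrix (Fin 2) (Fin 2) (w.1.adicCompletion L))} =
      {B : Submodule (Valued.integer (w.1.adicCompletion L)) (Fin 2 → (w.1.adicCompletion L)) | IsSelfDualLattice (galAdicCompletionMap (L := L) (IsCMField.complexConj L) hw) (ϖ : (w.1.adicCompletion L)) (placeForm (Matrix.of fun i j : Fin 2 => if i.val + j.val + 1 = 2 then (1 : L) else 0) w.1) B ∧ mapGL (((localNonsplitEquiv (IsCMField.complexConj L) (Matrix.of fun i j : Fin 2 => if i.val + j.val + 1 = 2 then (1 : L) else 0) (IsCMField.complexConj_ne_one L) w hw) γ₂ : ↥(unitaryGroupOfForm (galAdicCompletionMap (L := L) (IsCMField.complexConj L) hw) (placeForm (Matrix.of fun i j : Fin 2 => if i.val + j.val + 1 = 2 then (1 : L) else 0) w.1))) : GL (Fin 2) (w.1.adicCompletion L)) B = B ∧ Q B}.ncard := by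
  have hc1 : IsCMField.complexConj L ≠ 1 := IsCMField.complexConj_ne_one L
  have hσ : ∀ a, (galAdicCompletionMap (L := L) (IsCMField.complexConj L) hw) ((galAdicCompletionMap (L := L) (IsCMField.complexConj L) hw) a) = a := fun a =>
    Liu2021.galAdicCompletionMap_galAdicCompletionMap_self (↥(maximalRealSubfield L)) L (IsCMField.complexConj L)
      (AlgEquiv.ext fun x => IsCMField.complexConj_apply_apply L x) hw a
  have hvσ : ∀ a, Valued.v ((galAdicCompletionMap (L := L) (IsCMField.complexConj L) hw) a) = Valued.v a := fun a => valued_galAdicCompletionMap (L := L) (IsCMField.complexConj L) hw a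
  have h2w : Valued.v (2 : (w.1.adicCompletion L)) = 1 := by
    have h := ((Valuation.integer.integers (ValuativeRel.valuation (w.1.adicCompletion L))).isUnit_iff_valuation_eq_one).1 h2
    exact (v_eq_one_iff_valuation_eq_one _).2 h
  have hϖ0 : (ϖ : (w.1.adicCompletion L)) ≠ 0 := ϖ.ne_zero
  have hϖ1 : Valued.v (ϖ : (w.1.adicCompletion L)) ≤ 1 := by rw [hϖ, ← WithZero.exp_zero]; exact WithZero.exp_le_exp.2 (by norm_num)
  have hK : ∀ g : ((cmDatum L 2 (Matrix.of fun i j : Fin 2 => if i.val + j.val + 1 = 2 then (1 : L) else 0)).Local v), g ∈ (cmLocalIntegralLevel L 2 (Matrix.of fun i j : Fin 2 => if i.val + j.val + 1 = 2 then (1 : L) else 0) v) ↔ (((localNonsplitEquiv (IsCMField.complexConj L) (Matrix.of fun i j : Fin 2 => if i.val + j.val + 1 = 2 then (1 : L) else 0) (IsCMField.complexConj_ne_one L) w hw) g : ↥(unitaryGroupOfForm (galAdicCompletionMap (L := L) (IsCMField.complexConj L) hw) (placeForm (Matrix.of fun i j : Fin 2 => if i.val + j.val + 1 = 2 then (1 :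 L) else 0) w.1))) : GL (Fin 2) (w.1.adicCompletion L)) ∈ glInt 2 (w.1.adicCompletion L) := fun g =>
    mem_localIntegralLevel_iff_of_smul_eq (IsCMField.complexConj L) 2 (Matrix.of fun i j : Fin 2 => if i.val + j.val + 1 = 2 then (1 : L) else 0) hc1 w hw g
  -- the label through `e₂` of a `K⁰`-conjugate
  have hmap : ∀ k x : ((cmDatum L 2 (Matrix.of fun i j : Fin 2 => if i.val + j.val + 1 = 2 then (1 : L) else 0)).Local v), ((localNonsplitEquiv (IsCMField.complexConj L) (Matrix.of fun i j : Fin 2 => if i.val + j.val + 1 = 2 then (1 : L) else 0) (IsCMField.complexConj_ne_one L) w hw) (k⁻¹ * x * k) : ↥(unitaryGroupOfForm (galAdicCompletionMap (L := L) (IsCMField.complexConj L) hw) (placeForm (Matrix.of fun i j : Fin 2 => if i.val + j.val + 1 = 2 then (1 : L) else 0) w.1))) = (((localNonsplitEquiv (IsCMField.complexConj L) (Matrix.of fun i j : Fin 2 => if i.val + j.val + 1 = 2 then (1 : L) else 0) (IsCMField.complexConj_ne_one L) w hw) k : ↥(unitaryGroupOfForm (galAdicCompletionMap (L := L) (IsCMField.complexConj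 L) hw) (placeForm (Matrix.of fun i j : Fin 2 => if i.val + j.val + 1 = 2 then (1 : L) else 0) w.1))))⁻¹ * ((localNonsplitEquiv (IsCMField.complexConj L) (Matrix.of fun i j : Fin 2 => if i.val + j.val + 1 = 2 then (1 : L) else 0) (IsCMField.complexConj_ne_one L) w hw) x : ↥(unitaryGroupOfForm (galAdicCompletionMap (L := L) (IsCMField.complexConj L) hw) (placeForm (Matrix.of fun i j : Fin 2 => if i.val + j.val + 1 = 2 then (1 : L) else 0) w.1))) * ((localNonsplitEquiv (IsCMField.complexConj L) (Matrix.of fun i j : Fin 2 => if i.val + j.val + 1 = 2 then (1 : L) else 0) (IsCMField.complexConj_ne_one L) w hw) k : ↥(unitaryGroupOfForm (galAdicCompletionMap (L := L) (IsCMField.complexConj L) hw) (placeForm (Matrix.of fun i j : Fin 2 => if i.val + j.val + 1 = 2 then (1 : L) else 0) w.1))) := fun k x => by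
    have hm1 := map_mul (localNonsplitEquiv (IsCMField.complexConj L) (Matrix.of fun i j : Fin 2 => if i.val + j.val + 1 = 2 then (1 : L) else 0) (IsCMField.complexConj_ne_one L) w hw) (k⁻¹ * x) k
    have hm2 := map_mul (localNonsplitEquiv (IsCMField.complexConj L) (Matrix.of fun i j : Fin 2 => if i.val + j.val + 1 = 2 then (1 : L) else 0) (IsCMField.complexConj_ne_one L) w hw) k⁻¹ x
    have hm3 := map_inv (localNonsplitEquiv (IsCMField.complexConj L) (Matrix.of fun i j : Fin 2 => if i.val + j.val + 1 = 2 then (1 : L) else 0) (IsCMField.complexConj_ne_one L) w hw) k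
    rw [hm2, hm3] at hm1
    exact hm1
  have hQK : ∀ k ∈ (cmLocalIntegralLevel L 2 (Matrix.of fun i j : Fin 2 => if i.val + j.val + 1 = 2 then (1 : L) else 0) v), ∀ x ∈ (cmLocalIntegralLevel L 2 (Matrix.of fun i j : Fin 2 => if i.val + j.val + 1 = 2 then (1 : L) else 0) v), (P ((((localNonsplitEquiv (IsCMField.complexConj L) (Matrix.of fun i j : Fin 2 => if i.val + j.val + 1 = 2 then (1 : L) else 0) (IsCMField.complexConj_ne_one L) w hw) (k⁻¹ * x * k) : ↥(unitaryGroupOfForm (galAdicCompletionMap (L := L) (IsCMField.complexConj L) hw) (placeForm (Matrix.of fun i j : Fin 2 => if i.val + j.val + 1 = 2 then (1 : L) else 0) w.1))) : GL (Fin 2) (w.1.adicCompletion L)) : Matrix (Fin 2) (Fin 2) (w.1.adicCompletion L)) ↔ P ((((localNonsplitEquiv (IsCMField.complexConj L) (Matrix.of fun i j : Fin 2 => if i.val + j.val + 1 = 2 then (1 : L) else 0) (IsCMField.complexConj_ne_one L) w hw) x : ↥(unitaryGroupOfForm (galAdicCompletionMap (L := L) (IsCMField.complexConj L) hw) (placeForm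 (Matrix.of fun i j : Fin 2 => if i.val + j.val + 1 = 2 then (1 : L) else 0) w.1))) : GL (Fin 2) (w.1.adicCompletion L)) : Matrix (Fin 2) (Fin 2) (w.1.adicCompletion L))) := fun k hk x hx => by
    rw [hmap]
    exact hPconj _ _ ((hK k).1 hk) ((hK x).1 hx)
  have hQmem : ∀ x : ((cmDatum L 2 (Matrix.of fun i j : Fin 2 => if i.val + j.val + 1 = 2 then (1 : L) else 0)).Local v), P ((((localNonsplitEquiv (IsCMField.complexConj L) (Matrix.of fun i j : Fin 2 => if i.val + j.val + 1 = 2 then (1 : L) else 0) (IsCMField.complexConj_ne_one L) w hw) x : ↥(unitaryGroupOfForm (galAdicCompletionMap (L := L) (IsCMField.complexConj L) hw) (placeForm (Matrix.of fun i j : Fin 2 => if i.val + j.val + 1 = 2 then (1 : L) else 0) w.1))) : GL (Fin 2) (w.1.adicCompletion L)) : Matrix (Fin 2) (Fin 2) (w.1.adicCompletion L)) → x ∈ (cmLocalIntegralLevel L 2 (Matrix.of fun i j : Fin 2 => if i.val + j.val + 1 = 2 then (1 : L) else 0) v) := fun x hx =>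
    (hK x).2 ((Literature.NumberTheory.Automorphic.HermitianLatticeTree.mem_glInt_iff_forall_v_le_one_and_v_det_eq_one _).2
      ⟨hPint x hx, v_det_coe_eq_one_of_mem_placeForm L w hw ((localNonsplitEquiv (IsCMField.complexConj L) (Matrix.of fun i j : Fin 2 => if i.val + j.val + 1 = 2 then (1 : L) else 0) (IsCMField.complexConj_ne_one L) w hw) x)⟩)
  -- (1) set shape
  have h1 := natCard_setOf_exists_mk_eq_ncard_fixedBy_sep (cmLocalIntegralLevel L 2 (Matrix.of fun i j : Fin 2 => if i.val + j.val + 1 = 2 then (1 : L) else 0) v) γ₂ (fun x => P ((((localNonsplitEquiv (IsCMField.complexConj L) (Matrix.of fun i j : Fin 2 => if i.val + j.val + 1 = 2 then (1 : L) else 0) (IsCMField.complexConj_ne_one L) w hw) x : ↥(unitaryGroupOfForm (galAdicCompletionMap (L := L) (IsCMField.complexConj L) hw) (placeForm (Matrix.of fun i j : Fin 2 => if i.val + j.val + 1 = 2 then (1 : L) else 0) w.1))) : GL (Fin 2) (w.1.adicCompletion L)) : Matrix (Fin 2) (Fin 2) (w.1.adicCompletion L))) hQK hQmem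
  -- (2) frame transport along `e₂`
  have hK' : ∀ g : ((cmDatum L 2 (Matrix.of fun i j : Fin 2 => if i.val + j.val + 1 = 2 then (1 : L) else 0)).Local v), g ∈ (cmLocalIntegralLevel L 2 (Matrix.of fun i j : Fin 2 => if i.val + j.val + 1 = 2 then (1 : L) else 0) v) ↔ (localNonsplitEquiv (IsCMField.complexConj L) (Matrix.of fun i j : Fin 2 => if i.val + j.val + 1 = 2 then (1 : L) else 0) (IsCMField.complexConj_ne_one L) w hw).toMulEquiv g ∈ (glInt 2 (w.1.adicCompletion L)).subgroupOf (unitaryGroupOfForm (galAdicCompletionMap (L := L) (IsCMField.complexConj L) hw) (placeForm (Matrix.of fun i j : Fin 2 => if i.val + j.val + 1 = 2 then (1 : L) else 0) w.1)) := fun g => by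
    rw [Subgroup.mem_subgroupOf]; exact hK g
  have h2' := ncard_fixedBy_sep_congr (cmLocalIntegralLevel L 2 (Matrix.of fun i j : Fin 2 => if i.val + j.val + 1 = 2 then (1 : L) else 0) v) ((glInt 2 (w.1.adicCompletion L)).subgroupOf (unitaryGroupOfForm (galAdicCompletionMap (L := L) (IsCMField.complexConj L) hw) (placeForm (Matrix.of fun i j : Fin 2 => if i.val + j.val + 1 = 2 then (1 : L) else 0) w.1))) (localNonsplitEquiv (IsCMField.complexConj L) (Matrix.of fun i j : Fin 2 => if i.val + j.val + 1 = 2 then (1 : L) else 0) (IsCMField.complexConj_ne_one L) w hw).toMulEquiv hK' γ₂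
    (fun x => P ((((localNonsplitEquiv (IsCMField.complexConj L) (Matrix.of fun i j : Fin 2 => if i.val + j.val + 1 = 2 then (1 : L) else 0) (IsCMField.complexConj_ne_one L) w hw) x : ↥(unitaryGroupOfForm (galAdicCompletionMap (L := L) (IsCMField.complexConj L) hw) (placeForm (Matrix.of fun i j : Fin 2 => if i.val + j.val + 1 = 2 then (1 : L) else 0) w.1))) : GL (Fin 2) (w.1.adicCompletion L)) : Matrix (Fin 2) (Fin 2) (w.1.adicCompletion L))) (fun u => P (((u : ↥(unitaryGroupOfForm (galAdicCompletionMap (L := L) (IsCMField.complexConj L) hw) (placeForm (Matrix.of fun i j : Fin 2 => if i.val + j.val + 1 = 2 then (1 : L) else 0) w.1))) : GL (Fin 2) (w.1.adicCompletion L)) : Matrix (Fin 2) (Fin 2) (w.1.adicCompletion L))) (fun x => Iff.rfl)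
    (fun k' hk' u hu => hPconj k' u (Subgroup.mem_subgroupOf.1 hk') (Subgroup.mem_subgroupOf.1 hu))
  -- (3) the dictionary (root self-dual ★ p848050, `U₂` transitive ★ p848050)
  have hL₀ : IsSelfDualLattice (galAdicCompletionMap (L := L) (IsCMField.complexConj L) hw) (ϖ : (w.1.adicCompletion L)) (placeForm (Matrix.of fun i j : Fin 2 => if i.val + j.val + 1 = 2 then (1 : L) else 0) w.1) (stdLattice (w.1.adicCompletion L) 2) := by
    rw [placeForm_antidiagOne]; exact isSelfDualLattice_stdLattice_two_of_v hϖ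
  have htrans : ∀ M : Submodule (Valued.integer (w.1.adicCompletion L)) (Fin 2 → (w.1.adicCompletion L)), IsSelfDualLattice (galAdicCompletionMap (L := L) (IsCMField.complexConj L) hw) (ϖ : (w.1.adicCompletion L)) (placeForm (Matrix.of fun i j : Fin 2 => if i.val + j.val + 1 = 2 then (1 : L) else 0) w.1) M →
      ∃ u : ↥(unitaryGroupOfForm (galAdicCompletionMap (L := L) (IsCMField.complexConj L) hw) (placeForm (Matrix.of fun i j : Fin 2 => if i.val + j.val + 1 = 2 then (1 : L) else 0) w.1)), M = mapGL ((u : ↥(unitaryGroupOfForm (galAdicCompletionMap (L := L) (IsCMField.complexConj L) hw) (placeForm (Matrix.of fun i j : Fin 2 => if i.val + j.val + 1 = 2 then (1 : L) else 0) w.1))) : GL (Fin 2) (w.1.adicCompletion L)) (stdLattice (w.1.adicCompletion L) 2) := fun M hM => by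
    rw [placeForm_antidiagOne] at hM ⊢
    exact exists_unitary_mapGL_stdLattice_eq_of_isSelfDualLattice_two_of_v_two hσ hvσ hϖ h2w hM
  have h3 := ncard_fixedBy_quotient_sep_eq_ncard_selfDual_fixed_sep (galAdicCompletionMap (L := L) (IsCMField.complexConj L) hw) (ϖ : (w.1.adicCompletion L)) (placeForm (Matrix.of fun i j : Fin 2 => if i.val + j.val + 1 = 2 then (1 : L) else 0) w.1) hL₀ htrans ((localNonsplitEquiv (IsCMField.complexConj L) (Matrix.of fun i j : Fin 2 => if i.val + j.val + 1 = 2 then (1 : L) else 0) (IsCMField.complexConj_ne_one L) w hw) γ₂)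
    (fun u => P (((u : ↥(unitaryGroupOfForm (galAdicCompletionMap (L := L) (IsCMField.complexConj L) hw) (placeForm (Matrix.of fun i j : Fin 2 => if i.val + j.val + 1 = 2 then (1 : L) else 0) w.1))) : GL (Fin 2) (w.1.adicCompletion L)) : Matrix (Fin 2) (Fin 2) (w.1.adicCompletion L))) Q hPQ
  exact h1.trans (h2'.trans h3)

/-! ## §2 (B-i) in lattice currency: the centred balls and row `0` -/

set_option maxHeartbeats 1600000 in
-- budget only: statement-heavy CM-place tokens (two currencies).
include hw in
/-- `|½ tr E₂γ₂| ≤ 1` for a unitary `γ₂` whose discriminant is integral (`|tr² − 4det| ≤ 1`, `|det| = 1`, `|2| = 1`). [cite: Rogawski1990, §4.9 p. 55] -/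
theorem v_half_trace_le_one_of_v_disc_le_one (h2 : IsUnit (2 : 𝒪[(w.1.adicCompletion L)])) (γ₂ : ((cmDatum L 2 (Matrix.of fun i j : Fin 2 => if i.val + j.val + 1 = 2 then (1 : L) else 0)).Local v))
    (hdisc : Valued.v ((((((localNonsplitEquiv (IsCMField.complexConj L) (Matrix.of fun i j : Fin 2 => if i.val + j.val + 1 = 2 then (1 : L) else 0) (IsCMField.complexConj_ne_one L) w hw) γ₂ : ↥(unitaryGroupOfForm (galAdicCompletionMap (L := L) (IsCMField.complexConj L) hw) (placeForm (Matrix.of fun i j : Fin 2 => if i.val + j.val + 1 = 2 then (1 : L) else 0) w.1))) : GL (Fin 2) (w.1.adicCompletion L)) : Matrix (Fin 2) (Fin 2) (w.1.adicCompletion L))).trace ^ 2 - 4 * (((((localNonsplitEquiv (IsCMField.complexConj L) (Matrix.of fun i j : Fin 2 => if i.val + j.val + 1 = 2 then (1 : L) else 0) (IsCMField.complexConj_ne_one L) w hw) γ₂ : ↥(unitaryGroupOfForm (galAdicCompletionMap (L := L) (IsCMField.complexConj L) hw) (placeForm (Matrix.of fun i j : Fin 2 => if i.val + j.val + 1 =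 2 then (1 : L) else 0) w.1))) : GL (Fin 2) (w.1.adicCompletion L)) : Matrix (Fin 2) (Fin 2) (w.1.adicCompletion L))).det) ≤ 1) : Valued.v ((((((localNonsplitEquiv (IsCMField.complexConj L) (Matrix.of fun i j : Fin 2 => if i.val + j.val + 1 = 2 then (1 : L) else 0) (IsCMField.complexConj_ne_one L) w hw) γ₂ : ↥(unitaryGroupOfForm (galAdicCompletionMap (L := L) (IsCMField.complexConj L) hw) (placeForm (Matrix.of fun i j : Fin 2 => if i.val + j.val + 1 = 2 then (1 : L) else 0) w.1))) : GL (Fin 2) (w.1.adicCompletion L)) : Matrix (Fin 2) (Fin 2) (w.1.adicCompletion L))).trace / 2) ≤ 1 := by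
  have h2w : Valued.v (2 : (w.1.adicCompletion L)) = 1 := by
    have h := ((Valuation.integer.integers (ValuativeRel.valuation (w.1.adicCompletion L))).isUnit_iff_valuation_eq_one).1 h2
    exact (v_eq_one_iff_valuation_eq_one _).2 h
  have hdet : Valued.v (((((localNonsplitEquiv (IsCMField.complexConj L) (Matrix.of fun i j : Fin 2 => if i.val + j.val + 1 = 2 then (1 : L) else 0) (IsCMField.complexConj_ne_one L) w hw) γ₂ : ↥(unitaryGroupOfForm (galAdicCompletionMap (L := L) (IsCMField.complexConj L) hw) (placeForm (Matrix.of fun i j : Fin 2 => if i.val + j.val + 1 = 2 then (1 : L) else 0) w.1))) : GL (Fin 2) (w.1.adicCompletion L)) : Matrix (Fin 2) (Fin 2) (w.1.adicCompletion L))).det = 1 := v_det_coe_eq_one_of_mem_placeForm L w hw ((localNonsplitEquiv (IsCMField.complexConj L) (Matrix.of fun i j : Fin 2 => if i.val + j.val + 1 = 2 then (1 : L) else 0) (IsCMField.complexConj_ne_one L) w hw) γ₂)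
  have h4 : Valued.v ((4 : (w.1.adicCompletion L)) * (((((localNonsplitEquiv (IsCMField.complexConj L) (Matrix.of fun i j : Fin 2 => if i.val + j.val + 1 = 2 then (1 : L) else 0) (IsCMField.complexConj_ne_one L) w hw) γ₂ : ↥(unitaryGroupOfForm (galAdicCompletionMap (L := L) (IsCMField.complexConj L) hw) (placeForm (Matrix.of fun i j : Fin 2 => if i.val + j.val + 1 = 2 then (1 : L) else 0) w.1))) : GL (Fin 2) (w.1.adicCompletion L)) : Matrix (Fin 2) (Fin 2) (w.1.adicCompletion L))).det) ≤ 1 := by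
    rw [map_mul, hdet, mul_one, show (4 : (w.1.adicCompletion L)) = 2 * 2 by norm_num, map_mul, h2w, mul_one]
  have htr2 : Valued.v ((((((localNonsplitEquiv (IsCMField.complexConj L) (Matrix.of fun i j : Fin 2 => if i.val + j.val + 1 = 2 then (1 : L) else 0) (IsCMField.complexConj_ne_one L) w hw) γ₂ : ↥(unitaryGroupOfForm (galAdicCompletionMap (L := L) (IsCMField.complexConj L) hw) (placeForm (Matrix.of fun i j : Fin 2 => if i.val + j.val + 1 = 2 then (1 : L) else 0) w.1))) : GL (Fin 2) (w.1.adicCompletion L)) : Matrix (Fin 2) (Fin 2) (w.1.adicCompletion L))).trace ^ 2) ≤ 1 := by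
    have h := Valuation.map_add Valued.v ((((((localNonsplitEquiv (IsCMField.complexConj L) (Matrix.of fun i j : Fin 2 => if i.val + j.val + 1 = 2 then (1 : L) else 0) (IsCMField.complexConj_ne_one L) w hw) γ₂ : ↥(unitaryGroupOfForm (galAdicCompletionMap (L := L) (IsCMField.complexConj L) hw) (placeForm (Matrix.of fun i j : Fin 2 => if i.val + j.val + 1 = 2 then (1 : L) else 0) w.1))) : GL (Fin 2) (w.1.adicCompletion L)) : Matrix (Fin 2) (Fin 2) (w.1.adicCompletion L))).trace ^ 2 - 4 * (((((localNonsplitEquiv (IsCMField.complexConj L) (Matrix.of fun i j : Fin 2 => if i.val + j.val + 1 = 2 then (1 : L) else 0) (IsCMField.complexConj_ne_one L) w hw) γ₂ : ↥(unitaryGroupOfForm (galAdicCompletionMap (L := L) (IsCMField.complexConj L) hw) (placeForm (Matrix.of fun i j : Fin 2 => if i.val + j.val + 1 = 2 then (1 : L) else 0) w.1))) : GL (Fin 2) (w.1.adicCompletion L)) : Matrix (Fin 2) (Fin 2) (w.1.adicCompletion L))).det) ((4 : (w.1.adicCompletion L)) * (((((localNonsplitEquiv (IsCMField.complexConj L)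 (Matrix.of fun i j : Fin 2 => if i.val + j.val + 1 = 2 then (1 : L) else 0) (IsCMField.complexConj_ne_one L) w hw) γ₂ : ↥(unitaryGroupOfForm (galAdicCompletionMap (L := L) (IsCMField.complexConj L) hw) (placeForm (Matrix.of fun i j : Fin 2 => if i.val + j.val + 1 = 2 then (1 : L) else 0) w.1))) : GL (Fin 2) (w.1.adicCompletion L)) : Matrix (Fin 2) (Fin 2) (w.1.adicCompletion L))).det)
    rw [sub_add_cancel] at h
    exact h.trans (max_le hdisc h4)
  have htr : Valued.v ((((((localNonsplitEquiv (IsCMField.complexConj L) (Matrix.of fun i j : Fin 2 => if i.val + j.val + 1 = 2 then (1 : L) else 0) (IsCMField.complexConj_ne_one L) w hw) γ₂ : ↥(unitaryGroupOfForm (galAdicCompletionMap (L := L) (IsCMField.complexConj L) hw) (placeForm (Matrix.of fun i j : Fin 2 => if i.val + j.val + 1 = 2 then (1 : L) else 0) w.1))) : GL (Fin 2) (w.1.adicCompletion L)) : Matrix (Fin 2) (Fin 2) (w.1.adicCompletion L))).trace) ≤ 1 := by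
    rw [map_pow] at htr2
    exact (pow_le_one_iff two_ne_zero).1 htr2
  rw [map_div₀, h2w, div_one]; exact htr

set_option maxHeartbeats 1600000 in
-- budget only: statement-heavy CM-place tokens (two currencies).
include hw in
/-- **(B-i) IN LATTICE CURRENCY — THE CENTRED BALLS.**  For a type-(2) `γ₂ ∈ U₂` (no root of `χ_{γ₂,w}` in `L_w`) with `|tr² − 4det|_w(γ_{2,w}) = exp(−2·2n)` at a tame-ramified
place and `j < n`, `c := ½ tr γ_{2,w}`, `Γ := e₂γ₂`: the `Γ`-fixed self-dual lattices `B` of `(L_w², Φ₂)` with `(Γ − c·1)B ⊆ ϖ^{2j}B` number `(q+1)·Σ_(k<n−j) q^k` (★ (B-i)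
`natCard_depthFixed_selfDual_and_modular_of_even_depth_ramified`, `K⁰` column, read through §1; its `C′` column is fed the vertex stabiliser of ★ `exists_vertexCover_of_ramified`).
[cite: LabesseLanglands1979, §2 Lemma 2.1 p. 8] [cite: Kottwitz1986, §3] [cite: Rogawski1990, §4.9 Lemma 4.9.3 p. 56] -/
theorem ncard_selfDual_fixed_centredBall_eq_of_even_depth_ramified (he : v.asIdeal.ramificationIdx' w.1.asIdeal ≠ 1) (h2 : IsUnit (2 : 𝒪[(w.1.adicCompletion L)]))
    (ϖ : (w.1.adicCompletion L)ˣ) (hϖ : Valued.v (ϖ : (w.1.adicCompletion L)) = WithZero.exp (-1 : ℤ))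
    (hσϖ : (galAdicCompletionMap (L := L) (IsCMField.complexConj L) hw) (ϖ : (w.1.adicCompletion L)) = -(ϖ : (w.1.adicCompletion L)))
    (γ₂ : ((cmDatum L 2 (Matrix.of fun i j : Fin 2 => if i.val + j.val + 1 = 2 then (1 : L) else 0)).Local v))
    (hirr : ¬ ∃ x : (w.1.adicCompletion L), ((((((localNonsplitEquiv (IsCMField.complexConj L) (Matrix.of fun i j : Fin 2 => if i.val + j.val + 1 = 2 then (1 : L) else 0) (IsCMField.complexConj_ne_one L) w hw) γ₂ : ↥(unitaryGroupOfForm (galAdicCompletionMap (L := L) (IsCMField.complexConj L) hw) (placeForm (Matrix.of fun i j : Fin 2 => if i.val + j.val + 1 = 2 then (1 : L) else 0) w.1))) : GL (Fin 2) (w.1.adicCompletion L)) : Matrix (Fin 2) (Fin 2) (w.1.adicCompletion L))).charpoly).IsRoot x)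
    {n : ℕ} (hN : Valued.v ((((((localNonsplitEquiv (IsCMField.complexConj L) (Matrix.of fun i j : Fin 2 => if i.val + j.val + 1 = 2 then (1 : L) else 0) (IsCMField.complexConj_ne_one L) w hw) γ₂ : ↥(unitaryGroupOfForm (galAdicCompletionMap (L := L) (IsCMField.complexConj L) hw) (placeForm (Matrix.of fun i j : Fin 2 => if i.val + j.val + 1 = 2 then (1 : L) else 0) w.1))) : GL (Fin 2) (w.1.adicCompletion L)) : Matrix (Fin 2) (Fin 2) (w.1.adicCompletion L))).trace ^ 2 - 4 * (((((localNonsplitEquiv (IsCMField.complexConj L) (Matrix.of fun i j : Fin 2 => if i.val + j.val + 1 = 2 then (1 : L) else 0) (IsCMField.complexConj_ne_one L) w hw) γ₂ : ↥(unitaryGroupOfForm (galAdicCompletionMap (L := L) (IsCMField.complexConj L) hw) (placeForm (Matrix.of fun i j : Fin 2 => if i.val + j.val + 1 = 2 then (1 : L) else 0) w.1))) : GL (Fin 2) (w.1.adicCompletion L)) : Matrix (Fin 2) (Fin 2) (w.1.adicCompletion L))).det) = WithZero.exp (-((2 * (2 * n) : ℕ) : ℤ)))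
    {j : ℕ} (hj : j < n) :
    {B : Submodule (Valued.integer (w.1.adicCompletion L)) (Fin 2 → (w.1.adicCompletion L)) | IsSelfDualLattice (galAdicCompletionMap (L := L) (IsCMField.complexConj L) hw) (ϖ : (w.1.adicCompletion L)) (placeForm (Matrix.of fun i j : Fin 2 => if i.val + j.val + 1 = 2 then (1 : L) else 0) w.1) B ∧ mapGL (((localNonsplitEquiv (IsCMField.complexConj L) (Matrix.of fun i j : Fin 2 => if i.val + j.val + 1 = 2 then (1 : L) else 0) (IsCMField.complexConj_ne_one L) w hw) γ₂ : ↥(unitaryGroupOfForm (galAdicCompletionMap (L := L) (IsCMField.complexConj L) hw) (placeForm (Matrix.of fun i j : Fin 2 => if i.val + j.val + 1 = 2 then (1 : L) else 0) w.1))) : GL (Fin 2) (w.1.adicCompletion L)) B = B ∧ B.map ((Matrix.toLin' (((((localNonsplitEquiv (IsCMField.complexConj L) (Matrix.of fun i j : Fin 2 => if i.val + j.val + 1 = 2 then (1 : L) else 0) (IsCMField.complexConj_ne_one L) w hw) γ₂ : ↥(unitaryGroupOfForm (galAdicCompletionMap (L := L) (IsCMField.complexConj L) hw) (placeForm (Matrix.of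 fun i j : Fin 2 => if i.val + j.val + 1 = 2 then (1 : L) else 0) w.1))) : GL (Fin 2) (w.1.adicCompletion L)) : Matrix (Fin 2) (Fin 2) (w.1.adicCompletion L)) - ((((((localNonsplitEquiv (IsCMField.complexConj L) (Matrix.of fun i j : Fin 2 => if i.val + j.val + 1 = 2 then (1 : L) else 0) (IsCMField.complexConj_ne_one L) w hw) γ₂ : ↥(unitaryGroupOfForm (galAdicCompletionMap (L := L) (IsCMField.complexConj L) hw) (placeForm (Matrix.of fun i j : Fin 2 => if i.val + j.val + 1 = 2 then (1 : L) else 0) w.1))) : GL (Fin 2) (w.1.adicCompletion L)) : Matrix (Fin 2) (Fin 2) (w.1.adicCompletion L))).trace / 2) • (1 : Matrix (Fin 2) (Fin 2) (w.1.adicCompletion L)))).restrictScalars (Valued.integer (w.1.adicCompletion L))) ≤ scaleLattice ((ϖ : (w.1.adicCompletion L)) ^ (2 * j)) B}.ncard =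
      ((Nat.card (𝓞 ↥(maximalRealSubfield L) ⧸ v.asIdeal)) + 1) * ∑ k ∈ Finset.range (n - j), (Nat.card (𝓞 ↥(maximalRealSubfield L) ⧸ v.asIdeal)) ^ k := by
  have hc1 : IsCMField.complexConj L ≠ 1 := IsCMField.complexConj_ne_one L
  have hσ : ∀ a, (galAdicCompletionMap (L := L) (IsCMField.complexConj L) hw) ((galAdicCompletionMap (L := L) (IsCMField.complexConj L) hw) a) = a := fun a =>
    Liu2021.galAdicCompletionMap_galAdicCompletionMap_self (↥(maximalRealSubfield L)) L (IsCMField.complexConj L)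
      (AlgEquiv.ext fun x => IsCMField.complexConj_apply_apply L x) hw a
  have hvσ : ∀ a, Valued.v ((galAdicCompletionMap (L := L) (IsCMField.complexConj L) hw) a) = Valued.v a := fun a => valued_galAdicCompletionMap (L := L) (IsCMField.complexConj L) hw a
  have h2w : Valued.v (2 : (w.1.adicCompletion L)) = 1 := by
    have h := ((Valuation.integer.integers (ValuativeRel.valuation (w.1.adicCompletion L))).isUnit_iff_valuation_eq_one).1 h2
    exact (v_eq_one_iff_valuation_eq_one _).2 h
  have hϖ0 : (ϖ : (w.1.adicCompletion L)) ≠ 0 := ϖ.ne_zero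
  have hϖ1 : Valued.v (ϖ : (w.1.adicCompletion L)) ≤ 1 := by rw [hϖ, ← WithZero.exp_zero]; exact WithZero.exp_le_exp.2 (by norm_num)
  have hc : Valued.v ((((((localNonsplitEquiv (IsCMField.complexConj L) (Matrix.of fun i j : Fin 2 => if i.val + j.val + 1 = 2 then (1 : L) else 0) (IsCMField.complexConj_ne_one L) w hw) γ₂ : ↥(unitaryGroupOfForm (galAdicCompletionMap (L := L) (IsCMField.complexConj L) hw) (placeForm (Matrix.of fun i j : Fin 2 => if i.val + j.val + 1 = 2 then (1 : L) else 0) w.1))) : GL (Fin 2) (w.1.adicCompletion L)) : Matrix (Fin 2) (Fin 2) (w.1.adicCompletion L))).trace / 2) ≤ 1 :=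
    v_half_trace_le_one_of_v_disc_le_one L v w hw h2 γ₂ (by rw [hN, ← WithZero.exp_zero]; exact WithZero.exp_le_exp.2 (by omega))
  have hr : Valued.v ((ϖ : (w.1.adicCompletion L)) ^ (2 * j)) ≤ 1 := by rw [map_pow]; exact pow_le_one' hϖ1 _
  obtain ⟨K₂, -, -, hK1, hKo, hKc, -⟩ := exists_vertexCover_of_ramified L v w hw he h2w ϖ hϖ hσϖ
  have hB := (natCard_depthFixed_selfDual_and_modular_of_even_depth_ramified L v w hw he h2 ϖ hϖ hσϖ (K₂ 1) hK1 (hKo 1) (hKc 1) γ₂ hirr hN hj).1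
  refine Eq.trans (natCard_cosets_label_eq_ncard_selfDual_fixed_ramified L v w hw h2 ϖ hϖ γ₂
    (fun Y => ∀ a b : Fin 2, Valued.v ((Y - ((((((localNonsplitEquiv (IsCMField.complexConj L) (Matrix.of fun i j : Fin 2 => if i.val + j.val + 1 = 2 then (1 : L) else 0) (IsCMField.complexConj_ne_one L) w hw) γ₂ : ↥(unitaryGroupOfForm (galAdicCompletionMap (L := L) (IsCMField.complexConj L) hw) (placeForm (Matrix.of fun i j : Fin 2 => if i.val + j.val + 1 = 2 then (1 : L) else 0) w.1))) : GL (Fin 2) (w.1.adicCompletion L)) : Matrix (Fin 2) (Fin 2) (w.1.adicCompletion L))).trace / 2) • (1 : Matrix (Fin 2) (Fin 2) (w.1.adicCompletion L))) a b) ≤ Valued.v ((ϖ : (w.1.adicCompletion L)) ^ (2 * j)))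
    (fun B => B.map ((Matrix.toLin' (((((localNonsplitEquiv (IsCMField.complexConj L) (Matrix.of fun i j : Fin 2 => if i.val + j.val + 1 = 2 then (1 : L) else 0) (IsCMField.complexConj_ne_one L) w hw) γ₂ : ↥(unitaryGroupOfForm (galAdicCompletionMap (L := L) (IsCMField.complexConj L) hw) (placeForm (Matrix.of fun i j : Fin 2 => if i.val + j.val + 1 = 2 then (1 : L) else 0) w.1))) : GL (Fin 2) (w.1.adicCompletion L)) : Matrix (Fin 2) (Fin 2) (w.1.adicCompletion L)) - ((((((localNonsplitEquiv (IsCMField.complexConj L) (Matrix.of fun i j : Fin 2 => if i.val + j.val + 1 = 2 then (1 : L) else 0) (IsCMField.complexConj_ne_one L) w hw) γ₂ : ↥(unitaryGroupOfForm (galAdicCompletionMap (L := L) (IsCMField.complexConj L) hw) (placeForm (Matrix.of fun i j : Fin 2 => if i.val + j.val + 1 = 2 then (1 : L) else 0) w.1))) : GL (Fin 2) (w.1.adicCompletion L)) : Matrix (Fin 2) (Fin 2) (w.1.adicCompletion L))).trace / 2) • (1 : Matrix (Fin 2) (Fin 2) (w.1.adicCompletion L)))).restrictScalars (Valued.integer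 (w.1.adicCompletion L))) ≤ scaleLattice ((ϖ : (w.1.adicCompletion L)) ^ (2 * j)) B)
    (fun x hx => forall_v_le_one_of_forall_v_sub_smul_le hc hr hx)
    (fun k x hk _ => forall_v_units_conj_sub_smul_le_iff_of_mem_glInt hk _ _ _)
    (fun g _ => forall_v_coe_conj_sub_smul_le_iff_map_le_scaleLattice (pow_ne_zero _ hϖ0) _ _ _)).symm ?_
  exact hB

set_option maxHeartbeats 1600000 in
-- budget only: statement-heavy CM-place tokens.
include hw in
/-- `|½ tr Γ − 1| ≤ |ϖ²|` for a 2-deep `Γ = e₂γ₂` (`|(Γ − 1)_{ab}| ≤ |ϖ²|`, `|2| = 1`). [cite: Rogawski1990, §4.9 p. 55] -/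
theorem v_half_trace_sub_one_le_of_twoDeep (h2 : IsUnit (2 : 𝒪[(w.1.adicCompletion L)])) (ϖ : (w.1.adicCompletion L)ˣ) (γ₂ : ((cmDatum L 2 (Matrix.of fun i j : Fin 2 => if i.val + j.val + 1 = 2 then (1 : L) else 0)).Local v))
    (hdeep : ∀ a b : Fin 2, Valued.v ((((((localNonsplitEquiv (IsCMField.complexConj L) (Matrix.of fun i j : Fin 2 => if i.val + j.val + 1 = 2 then (1 : L) else 0) (IsCMField.complexConj_ne_one L) w hw) γ₂ : ↥(unitaryGroupOfForm (galAdicCompletionMap (L := L) (IsCMField.complexConj L) hw) (placeForm (Matrix.of fun i j : Fin 2 => if i.val + j.val + 1 = 2 then (1 : L) else 0) w.1))) : GL (Fin 2) (w.1.adicCompletion L)) : Matrix (Fin 2) (Fin 2) (w.1.adicCompletion L)) - 1) a b) ≤ Valued.v ((ϖ : (w.1.adicCompletion L)) ^ 2)) :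
    Valued.v ((((((localNonsplitEquiv (IsCMField.complexConj L) (Matrix.of fun i j : Fin 2 => if i.val + j.val + 1 = 2 then (1 : L) else 0) (IsCMField.complexConj_ne_one L) w hw) γ₂ : ↥(unitaryGroupOfForm (galAdicCompletionMap (L := L) (IsCMField.complexConj L) hw) (placeForm (Matrix.of fun i j : Fin 2 => if i.val + j.val + 1 = 2 then (1 : L) else 0) w.1))) : GL (Fin 2) (w.1.adicCompletion L)) : Matrix (Fin 2) (Fin 2) (w.1.adicCompletion L))).trace / 2 - 1) ≤ Valued.v ((ϖ : (w.1.adicCompletion L)) ^ 2) := by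
  have h2w : Valued.v (2 : (w.1.adicCompletion L)) = 1 := by
    have h := ((Valuation.integer.integers (ValuativeRel.valuation (w.1.adicCompletion L))).isUnit_iff_valuation_eq_one).1 h2
    exact (v_eq_one_iff_valuation_eq_one _).2 h
  have h20 : (2 : (w.1.adicCompletion L)) ≠ 0 := fun h => by rw [h, map_zero] at h2w; exact zero_ne_one h2w
  have e : (((((localNonsplitEquiv (IsCMField.complexConj L) (Matrix.of fun i j : Fin 2 => if i.val + j.val + 1 = 2 then (1 : L) else 0) (IsCMField.complexConj_ne_one L) w hw) γ₂ : ↥(unitaryGroupOfForm (galAdicCompletionMap (L := L) (IsCMField.complexConj L) hw) (placeForm (Matrix.of fun i j : Fin 2 => if i.val + j.val + 1 = 2 then (1 : L) else 0) w.1))) : GL (Fin 2) (w.1.adicCompletion L)) : Matrix (Fin 2) (Fin 2) (w.1.adicCompletion L))).trace / 2 - 1 = (((((((localNonsplitEquiv (IsCMField.complexConj L) (Matrix.of fun i j : Fin 2 => if i.val + j.val + 1 = 2 then (1 : L) else 0) (IsCMField.complexConj_ne_one L) w hw) γ₂ : ↥(unitaryGroupOfForm (galAdicCompletionMap (L :=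 L) (IsCMField.complexConj L) hw) (placeForm (Matrix.of fun i j : Fin 2 => if i.val + j.val + 1 = 2 then (1 : L) else 0) w.1))) : GL (Fin 2) (w.1.adicCompletion L)) : Matrix (Fin 2) (Fin 2) (w.1.adicCompletion L)) - 1) 0 0) + ((((((localNonsplitEquiv (IsCMField.complexConj L) (Matrix.of fun i j : Fin 2 => if i.val + j.val + 1 = 2 then (1 : L) else 0) (IsCMField.complexConj_ne_one L) w hw) γ₂ : ↥(unitaryGroupOfForm (galAdicCompletionMap (L := L) (IsCMField.complexConj L) hw) (placeForm (Matrix.of fun i j : Fin 2 => if i.val + j.val + 1 = 2 then (1 : L) else 0) w.1))) : GL (Fin 2) (w.1.adicCompletion L)) : Matrix (Fin 2) (Fin 2) (w.1.adicCompletion L)) - 1) 1 1)) / 2 := by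
    rw [Matrix.trace_fin_two, Matrix.sub_apply, Matrix.sub_apply, Matrix.one_apply_eq, Matrix.one_apply_eq]
    field_simp
    ring
  rw [e, map_div₀, h2w, div_one]
  exact (Valuation.map_add _ _ _).trans (max_le (hdeep 0 0) (hdeep 1 1))

set_option maxHeartbeats 1600000 in
-- budget only: statement-heavy CM-place tokens (two currencies).
include hw in
/-- **ROW `0` IN LATTICE CURRENCY** (the W side of ★ `ncard_selfDual_fixed_axis_zero_eq`).  For a type-(2) `γ₂` of even discriminant depth `exp(−2·2n)`, `n ≥ 1`, whose one-place
matrix `Γ = e₂γ₂` is 2-deep (`|(Γ − 1)_{ab}| ≤ |ϖ²|`): `#{B ∣ SD, ΓB = B, (Γ−1)B ⊆ ϖB ∧ (Γ−1)B ⊆ ϖ²B} = (q+1)·Σ_(k<n−1) q^k` (= `m⁰(N−2)`, the inner ball: ★ (B-i) at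
`j = 1` for `n ≥ 2`, ★ `natCard_depthFixed_selfDual_top_of_even_depth_ramified` for `n = 1`; centred ↔ plain by ★ `map_sub_smul_one_le_scaleLattice_sq_iff_lev_and_lev`, `|c − 1| ≤ |ϖ²|`).
[cite: LabesseLanglands1979, §2 Lemma 2.1 p. 8] [cite: Kottwitz1986, §3] [cite: Rogawski1990, §4.9 Lemma 4.9.3 p. 56] -/
theorem ncard_selfDual_fixed_lev_lev_eq_of_even_depth_ramified (he : v.asIdeal.ramificationIdx' w.1.asIdeal ≠ 1) (h2 : IsUnit (2 : 𝒪[(w.1.adicCompletion L)]))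
    (ϖ : (w.1.adicCompletion L)ˣ) (hϖ : Valued.v (ϖ : (w.1.adicCompletion L)) = WithZero.exp (-1 : ℤ))
    (hσϖ : (galAdicCompletionMap (L := L) (IsCMField.complexConj L) hw) (ϖ : (w.1.adicCompletion L)) = -(ϖ : (w.1.adicCompletion L)))
    (γ₂ : ((cmDatum L 2 (Matrix.of fun i j : Fin 2 => if i.val + j.val + 1 = 2 then (1 : L) else 0)).Local v))
    (hirr : ¬ ∃ x : (w.1.adicCompletion L), ((((((localNonsplitEquiv (IsCMField.complexConj L) (Matrix.of fun i j : Fin 2 => if i.val + j.val + 1 = 2 then (1 : L) else 0) (IsCMField.complexConj_ne_one L) w hw) γ₂ : ↥(unitaryGroupOfForm (galAdicCompletionMap (L := L) (IsCMField.complexConj L) hw) (placeForm (Matrix.of fun i j : Fin 2 => if i.val + j.val + 1 = 2 then (1 : L) else 0) w.1))) : GL (Fin 2) (w.1.adicCompletion L)) : Matrix (Fin 2) (Fin 2) (w.1.adicCompletion L))).charpoly).IsRoot x)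
    {n : ℕ} (hN : Valued.v ((((((localNonsplitEquiv (IsCMField.complexConj L) (Matrix.of fun i j : Fin 2 => if i.val + j.val + 1 = 2 then (1 : L) else 0) (IsCMField.complexConj_ne_one L) w hw) γ₂ : ↥(unitaryGroupOfForm (galAdicCompletionMap (L := L) (IsCMField.complexConj L) hw) (placeForm (Matrix.of fun i j : Fin 2 => if i.val + j.val + 1 = 2 then (1 : L) else 0) w.1))) : GL (Fin 2) (w.1.adicCompletion L)) : Matrix (Fin 2) (Fin 2) (w.1.adicCompletion L))).trace ^ 2 - 4 * (((((localNonsplitEquiv (IsCMField.complexConj L) (Matrix.of fun i j : Fin 2 => if i.val + j.val + 1 = 2 then (1 : L) else 0) (IsCMField.complexConj_ne_one L) w hw) γ₂ : ↥(unitaryGroupOfForm (galAdicCompletionMap (L := L) (IsCMField.complexConj L) hw) (placeForm (Matrix.of fun i j : Fin 2 => if i.val + j.val + 1 = 2 then (1 : L) else 0) w.1))) : GL (Fin 2) (w.1.adicCompletion L)) : Matrix (Fin 2) (Fin 2) (w.1.adicCompletion L))).det) = WithZero.exp (-((2 * (2 * n) : ℕ) : ℤ))) (hn1 : 1 ≤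 n)
    (hdeep : ∀ a b : Fin 2, Valued.v ((((((localNonsplitEquiv (IsCMField.complexConj L) (Matrix.of fun i j : Fin 2 => if i.val + j.val + 1 = 2 then (1 : L) else 0) (IsCMField.complexConj_ne_one L) w hw) γ₂ : ↥(unitaryGroupOfForm (galAdicCompletionMap (L := L) (IsCMField.complexConj L) hw) (placeForm (Matrix.of fun i j : Fin 2 => if i.val + j.val + 1 = 2 then (1 : L) else 0) w.1))) : GL (Fin 2) (w.1.adicCompletion L)) : Matrix (Fin 2) (Fin 2) (w.1.adicCompletion L)) - 1) a b) ≤ Valued.v ((ϖ : (w.1.adicCompletion L)) ^ 2)) :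
    {B : Submodule (Valued.integer (w.1.adicCompletion L)) (Fin 2 → (w.1.adicCompletion L)) | IsSelfDualLattice (galAdicCompletionMap (L := L) (IsCMField.complexConj L) hw) (ϖ : (w.1.adicCompletion L)) (placeForm (Matrix.of fun i j : Fin 2 => if i.val + j.val + 1 = 2 then (1 : L) else 0) w.1) B ∧ mapGL (((localNonsplitEquiv (IsCMField.complexConj L) (Matrix.of fun i j : Fin 2 => if i.val + j.val + 1 = 2 then (1 : L) else 0) (IsCMField.complexConj_ne_one L) w hw) γ₂ : ↥(unitaryGroupOfForm (galAdicCompletionMap (L := L) (IsCMField.complexConj L) hw) (placeForm (Matrix.of fun i j : Fin 2 => if i.val + j.val + 1 = 2 then (1 : L) else 0) w.1))) : GL (Fin 2) (w.1.adicCompletion L)) B = B ∧ (B.map ((Matrix.toLin' (((((localNonsplitEquiv (IsCMField.complexConj L) (Matrix.of fun i j : Fin 2 => if i.val + j.val + 1 = 2 then (1 : L) else 0) (IsCMField.complexConj_ne_one L) w hw) γ₂ : ↥(unitaryGroupOfForm (galAdicCompletionMap (L := L) (IsCMField.complexConj L) hw) (placeForm (Matrix.of fun i j : Fin 2 => if i.val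 + j.val + 1 = 2 then (1 : L) else 0) w.1))) : GL (Fin 2) (w.1.adicCompletion L)) : Matrix (Fin 2) (Fin 2) (w.1.adicCompletion L)) - 1)).restrictScalars (Valued.integer (w.1.adicCompletion L))) ≤ scaleLattice ((ϖ : (w.1.adicCompletion L))) B ∧ B.map ((Matrix.toLin' (((((localNonsplitEquiv (IsCMField.complexConj L) (Matrix.of fun i j : Fin 2 => if i.val + j.val + 1 = 2 then (1 : L) else 0) (IsCMField.complexConj_ne_one L) w hw) γ₂ : ↥(unitaryGroupOfForm (galAdicCompletionMap (L := L) (IsCMField.complexConj L) hw) (placeForm (Matrix.of fun i j : Fin 2 => if i.val + j.val + 1 = 2 then (1 : L) else 0) w.1))) : GL (Fin 2) (w.1.adicCompletion L)) : Matrix (Fin 2) (Fin 2) (w.1.adicCompletion L)) - 1)).restrictScalars (Valued.integer (w.1.adicCompletion L))) ≤ scaleLattice ((ϖ : (w.1.adicCompletion L)) ^ 2) B)}.ncard =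
      ((Nat.card (𝓞 ↥(maximalRealSubfield L) ⧸ v.asIdeal)) + 1) * ∑ k ∈ Finset.range (n - 1), (Nat.card (𝓞 ↥(maximalRealSubfield L) ⧸ v.asIdeal)) ^ k := by
  have hc1 : IsCMField.complexConj L ≠ 1 := IsCMField.complexConj_ne_one L
  have hσ : ∀ a, (galAdicCompletionMap (L := L) (IsCMField.complexConj L) hw) ((galAdicCompletionMap (L := L) (IsCMField.complexConj L) hw) a) = a := fun a =>
    Liu2021.galAdicCompletionMap_galAdicCompletionMap_self (↥(maximalRealSubfield L)) L (IsCMField.complexConj L)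
      (AlgEquiv.ext fun x => IsCMField.complexConj_apply_apply L x) hw a
  have hvσ : ∀ a, Valued.v ((galAdicCompletionMap (L := L) (IsCMField.complexConj L) hw) a) = Valued.v a := fun a => valued_galAdicCompletionMap (L := L) (IsCMField.complexConj L) hw a
  have h2w : Valued.v (2 : (w.1.adicCompletion L)) = 1 := by
    have h := ((Valuation.integer.integers (ValuativeRel.valuation (w.1.adicCompletion L))).isUnit_iff_valuation_eq_one).1 h2
    exact (v_eq_one_iff_valuation_eq_one _).2 h
  have hϖ0 : (ϖ : (w.1.adicCompletion L)) ≠ 0 := ϖ.ne_zero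
  have hϖ1 : Valued.v (ϖ : (w.1.adicCompletion L)) ≤ 1 := by rw [hϖ, ← WithZero.exp_zero]; exact WithZero.exp_le_exp.2 (by norm_num)
  have hc1' := v_half_trace_sub_one_le_of_twoDeep L v w hw h2 ϖ γ₂ hdeep
  have hc : Valued.v ((((((localNonsplitEquiv (IsCMField.complexConj L) (Matrix.of fun i j : Fin 2 => if i.val + j.val + 1 = 2 then (1 : L) else 0) (IsCMField.complexConj_ne_one L) w hw) γ₂ : ↥(unitaryGroupOfForm (galAdicCompletionMap (L := L) (IsCMField.complexConj L) hw) (placeForm (Matrix.of fun i j : Fin 2 => if i.val + j.val + 1 = 2 then (1 : L) else 0) w.1))) : GL (Fin 2) (w.1.adicCompletion L)) : Matrix (Fin 2) (Fin 2) (w.1.adicCompletion L))).trace / 2) ≤ 1 :=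
    v_half_trace_le_one_of_v_disc_le_one L v w hw h2 γ₂ (by rw [hN, ← WithZero.exp_zero]; exact WithZero.exp_le_exp.2 (by omega))
  have hr : Valued.v ((ϖ : (w.1.adicCompletion L)) ^ (2 * 1)) ≤ 1 := by rw [map_pow]; exact pow_le_one' hϖ1 _
  -- the centred ball of radius `ϖ^(2·1)` in coset currency, both ranges of `n`
  have hB : Nat.card {x : ((cmDatum L 2 (Matrix.of fun i j : Fin 2 => if i.val + j.val + 1 = 2 then (1 : L) else 0)).Local v) ⧸ (cmLocalIntegralLevel L 2 (Matrix.of fun i j : Fin 2 => if i.val + j.val + 1 = 2 then (1 : L) else 0) v) | ∃ h : ((cmDatum L 2 (Matrix.of fun i j : Fin 2 => if i.val + j.val + 1 = 2 then (1 : L) else 0)).Local v), x = (h : ((cmDatum L 2 (Matrix.of fun i j : Fin 2 => if i.val + j.val + 1 = 2 then (1 : L) else 0)).Local v) ⧸ (cmLocalIntegralLevel L 2 (Matrix.of fun i j : Fin 2 => if i.val + j.val + 1 = 2 then (1 : L) else 0) v)) ∧ ∀ a b : Fin 2, Valued.v ((((((localNonsplitEquiv (IsCMField.complexConj L) (Matrix.of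 fun i j : Fin 2 => if i.val + j.val + 1 = 2 then (1 : L) else 0) (IsCMField.complexConj_ne_one L) w hw) (h⁻¹ * γ₂ * h) : ↥(unitaryGroupOfForm (galAdicCompletionMap (L := L) (IsCMField.complexConj L) hw) (placeForm (Matrix.of fun i j : Fin 2 => if i.val + j.val + 1 = 2 then (1 : L) else 0) w.1))) : GL (Fin 2) (w.1.adicCompletion L)) : Matrix (Fin 2) (Fin 2) (w.1.adicCompletion L)) - ((((((localNonsplitEquiv (IsCMField.complexConj L) (Matrix.of fun i j : Fin 2 => if i.val + j.val + 1 = 2 then (1 : L) else 0) (IsCMField.complexConj_ne_one L) w hw) γ₂ : ↥(unitaryGroupOfForm (galAdicCompletionMap (L := L) (IsCMField.complexConj L) hw) (placeForm (Matrix.of fun i j : Fin 2 => if i.val + j.val + 1 = 2 then (1 : L) else 0) w.1))) : GL (Fin 2) (w.1.adicCompletion L)) : Matrix (Fin 2) (Fin 2) (w.1.adicCompletion L))).trace / 2) • (1 : Matrix (Fin 2) (Fin 2) (w.1.adicCompletion L))) a b) ≤ Valued.v ((ϖ : (w.1.adicCompletion L)) ^ (2 * 1))} = ((Nat.card (𝓞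 ↥(maximalRealSubfield L) ⧸ v.asIdeal)) + 1) * ∑ k ∈ Finset.range (n - 1), (Nat.card (𝓞 ↥(maximalRealSubfield L) ⧸ v.asIdeal)) ^ k := by
    by_cases hn : 2 ≤ n
    · obtain ⟨K₂, -, -, hK1, hKo, hKc, -⟩ := exists_vertexCover_of_ramified L v w hw he h2w ϖ hϖ hσϖ
      exact (natCard_depthFixed_selfDual_and_modular_of_even_depth_ramified L v w hw he h2 ϖ hϖ hσϖ (K₂ 1) hK1 (hKo 1) (hKc 1) γ₂ hirr hN (j := 1) (by omega)).1
    · have hn' : n = 1 := by omega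
      subst hn'
      exact natCard_depthFixed_selfDual_top_of_even_depth_ramified L v w hw he h2 ϖ hϖ hσϖ γ₂ hirr (le_refl 1) hN
  have hM := natCard_cosets_label_eq_ncard_selfDual_fixed_ramified L v w hw h2 ϖ hϖ γ₂
    (fun Y => ∀ a b : Fin 2, Valued.v ((Y - ((((((localNonsplitEquiv (IsCMField.complexConj L) (Matrix.of fun i j : Fin 2 => if i.val + j.val + 1 = 2 then (1 : L) else 0) (IsCMField.complexConj_ne_one L) w hw) γ₂ : ↥(unitaryGroupOfForm (galAdicCompletionMap (L := L) (IsCMField.complexConj L) hw) (placeForm (Matrix.of fun i j : Fin 2 => if i.val + j.val + 1 = 2 then (1 : L) else 0) w.1))) : GL (Fin 2) (w.1.adicCompletion L)) : Matrix (Fin 2) (Fin 2) (w.1.adicCompletion L))).trace / 2) • (1 : Matrix (Fin 2) (Fin 2) (w.1.adicCompletion L))) a b) ≤ Valued.v ((ϖ : (w.1.adicCompletion L)) ^ (2 * 1)))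
    (fun B => B.map ((Matrix.toLin' (((((localNonsplitEquiv (IsCMField.complexConj L) (Matrix.of fun i j : Fin 2 => if i.val + j.val + 1 = 2 then (1 : L) else 0) (IsCMField.complexConj_ne_one L) w hw) γ₂ : ↥(unitaryGroupOfForm (galAdicCompletionMap (L := L) (IsCMField.complexConj L) hw) (placeForm (Matrix.of fun i j : Fin 2 => if i.val + j.val + 1 = 2 then (1 : L) else 0) w.1))) : GL (Fin 2) (w.1.adicCompletion L)) : Matrix (Fin 2) (Fin 2) (w.1.adicCompletion L)) - ((((((localNonsplitEquiv (IsCMField.complexConj L) (Matrix.of fun i j : Fin 2 => if i.val + j.val + 1 = 2 then (1 : L) else 0) (IsCMField.complexConj_ne_one L) w hw) γ₂ : ↥(unitaryGroupOfForm (galAdicCompletionMap (L := L) (IsCMField.complexConj L) hw) (placeForm (Matrix.of fun i j : Fin 2 => if i.val + j.val + 1 = 2 then (1 : L) else 0) w.1))) : GL (Fin 2) (w.1.adicCompletion L)) : Matrix (Fin 2) (Fin 2) (w.1.adicCompletion L))).trace / 2) • (1 : Matrix (Fin 2) (Fin 2) (w.1.adicCompletion L)))).restrictScalars (Valued.integer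 (w.1.adicCompletion L))) ≤ scaleLattice ((ϖ : (w.1.adicCompletion L)) ^ (2 * 1)) B)
    (fun x hx => forall_v_le_one_of_forall_v_sub_smul_le hc hr hx)
    (fun k x hk _ => forall_v_units_conj_sub_smul_le_iff_of_mem_glInt hk _ _ _)
    (fun g _ => forall_v_coe_conj_sub_smul_le_iff_map_le_scaleLattice (pow_ne_zero _ hϖ0) _ _ _)
  rw [hM, show 2 * 1 = 2 from rfl] at hB
  rw [← hB]
  congr 1
  ext B
  simp only [Set.mem_setOf_eq]
  exact and_congr_right fun _ => and_congr_right fun _ => (map_sub_smul_one_le_scaleLattice_sq_iff_lev_and_lev _ hϖ0 hϖ1 hc1' B).symm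

end Literature.NumberTheory.Automorphic.UnitaryGroup

end
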